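import Mathlib.Combinatorics.Nullstellensatz
import Literature.Computability.AlgebraicComplexity.MS21ContinuantOrbitProofs
import HarnessLib

/-!
# Medini–Shpilka 2021, Cor 29: a hitting set of size `O(n⁶)` for the affine orbits of the continuant
# (`MS2021_cor_29_holds`)

Theorem-only companion of `MS21DenseOrbitsHittingSets.lean` (cell `val-lit`, seat x6 g3): a PROOF of
the typed fact `MS2021_cor_29` (existence-and-size form: one constant `c` such that over every field
with `|F| ≥ n²`, or infinite, a set of `≤ c · n⁶` points hits `⋃_{1 ≤ m ≤ n} C_m^{GLaff_n(F)}`), with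
`c = 8`, following the printed one-line proof "(cor:hit-cont) follows immediately from (thmhitcont),
(obsHitSetGen) and the construction of a uniform generator in (defsvgenhom)"
[MediniShpilka2021, arXiv p0020:L26]:

* (defsvgenhom) = Def 3.4 with `k = 1`: the UNIFORM SV-generator
  `Ĝ_i(y_1, y_2, z) = c_i · z · ∏_{j ≠ i} (y_1 - α_j y_2)`, `c_i = (∏_{j ≠ i} (α_i - α_j))⁻¹`, for `n`
  distinct `α_j ∈ F` — a uniform (homogeneous of degree `n`) `1`-independent map with individual
  degrees `≤ n - 1` in `y_1, y_2` and `≤ 1` in `z` (Obs 3.5) — here the lemmas `MS2021.svGenHom₁_*`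
  about any family `g` satisfying the defining equation (no new definition is introduced);
* (thmhitcont) = `MS2021_thm_28_holds` (tree): `f ∘ Ĝ ≠ 0` for `f ∈ C_m^{GLaff_n(F)}`;
* (obsHitSetGen) = Obs 18 (arXiv Obs 1.14): a nonzero polynomial with individual degrees `< |W_v|`
  does not vanish on the grid `∏_v W_v` — Mathlib's `MvPolynomial.eq_zero_of_eval_zero_at_prod_finset`
  — applied with `|W_{y_1}| = |W_{y_2}| = n(n-1) + 1 ≤ n²` and `|W_z| = n + 1` (`deg f ≤ m ≤ n`, so the
  individual degrees of `f ∘ Ĝ` are `≤ n(n-1)` and `≤ n`, `MS2021.degreeOf_bind₁_le`), whence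
  `|H| ≤ (n² )²(n+1) ≤ 8 n⁶` (the slack `8` covers `n = 1`, where two points are needed and
  `|F| ≥ 2 > n²` holds in every field).

No new definitions, no new facts (D-0026): net debt `−1`. HONEST FRAMING: existence with the printed
size only ("explicit" was dropped when typing — flagged WEAKER there); `VP ≠ VNP` is NOT proved.

## References
* [MediniShpilka2021] D. Medini, A. Shpilka, CCC 2021 (LIPIcs 200:19): Cor 29 (p.19:12) and its
  proof (arXiv:2102.05632 §4, held text p0020:L26), Def 3.2 / Def 3.4 / Obs 3.5 (p0017:L22-L47),
  Obs 18 = arXiv Obs 1.14 (p0006:L58-L63).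
-/

noncomputable section

open MvPolynomial Matrix

namespace Literature.Computability.AlgebraicComplexity

namespace MS2021

/-! ### Individual degrees under composition (for Obs 1.14) -/

section DegreeOf

variable {R : Type*} [CommSemiring R] {σ τ : Type*}

/-- `deg_v P(G_1, …, G_n) ≤ deg P · max_i deg_v G_i`: the individual degree of a composition.
[cite: MediniShpilka2021, Obs 18 = arXiv Obs 1.14 proof ("its individual degrees are bounded by d·r"), p0006:L62-L63] -/
theorem degreeOf_bind₁_le (G : σ → MvPolynomial τ R) (v : τ) {r : ℕ}
    (hG : ∀ i, degreeOf v (G i) ≤ r) (P : MvPolynomial σ R) :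
    degreeOf v (bind₁ G P) ≤ P.totalDegree * r := by
  classical
  conv_lhs => rw [P.as_sum, map_sum]
  refine (degreeOf_sum_le _ _ _).trans (Finset.sup_le fun m hm => ?_)
  rw [bind₁_monomial]
  refine (degreeOf_C_mul_le _ _ _).trans ((degreeOf_prod_le _ _ _).trans ?_)
  calc ∑ i ∈ m.support, degreeOf v (G i ^ m i)
      ≤ ∑ i ∈ m.support, m i * r := Finset.sum_le_sum fun i _ =>
          (degreeOf_pow_le _ _ _).trans (Nat.mul_le_mul_left _ (hG i))
    _ = (m.sum fun _ e => e) * r := by rw [Finsupp.sum, Finset.sum_mul]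
    _ ≤ P.totalDegree * r := Nat.mul_le_mul_right _ (le_totalDegree hm)

end DegreeOf

/-! ### Def 3.4 (`k = 1`): the uniform SV-generator `Ĝ_i = c_i · z · ∏_{j ≠ i} (y_1 - α_j y_2)` -/

section SVGen

variable {K : Type*} [Field K] {n : ℕ}

/-- Specialising the control variables of the uniform SV-generator to `(y_1, y_2) = (α_i, 1)` gives
`(0, …, 0, z, 0, …, 0)` (the `z` in coordinate `i`): the homogenised Lagrange property
`L_j(α_i) = δ_{ij}` (Def 3.2 / Def 3.4). [cite: MediniShpilka2021, Def 3.2, Def 3.4, Obs 3.5 (arXiv p0017:L22-L47)] -/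
theorem svGenHom₁_spec (α : Fin n ↪ K) (g : Fin n → MvPolynomial (Fin 2 ⊕ Unit) K)
    (hg : ∀ j, g j = C (∏ k ∈ Finset.univ.erase j, (α j - α k))⁻¹ * X (Sum.inr ()) *
      ∏ k ∈ Finset.univ.erase j, (X (Sum.inl 0) - C (α k) * X (Sum.inl 1)))
    (i j : Fin n) :
    aeval (Sum.elim (fun s => C (![α i, 1] s)) (fun _ => X ()) :
        Fin 2 ⊕ Unit → MvPolynomial Unit K) (g j) = if j = i then X () else 0 := by
  classical
  have hprod : aeval (Sum.elim (fun s => C (![α i, 1] s)) (fun _ => X ()) :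
      Fin 2 ⊕ Unit → MvPolynomial Unit K)
      (∏ k ∈ Finset.univ.erase j, (X (Sum.inl 0) - C (α k) * X (Sum.inl 1))) =
      C (∏ k ∈ Finset.univ.erase j, (α i - α k)) := by
    rw [map_prod, map_prod]
    refine Finset.prod_congr rfl fun k _ => ?_
    simp [map_sub, map_mul]
  rw [hg, map_mul, map_mul, aeval_C, aeval_X, hprod, algebraMap_eq, Sum.elim_inr, mul_right_comm,
    ← map_mul]
  split_ifs with hij
  · subst hij
    have hne : ∏ k ∈ Finset.univ.erase j, (α j - α k) ≠ 0 :=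
      Finset.prod_ne_zero_iff.2 fun k hk =>
        sub_ne_zero.2 fun h => (Finset.ne_of_mem_erase hk) (α.injective h).symm
    rw [inv_mul_cancel₀ hne, map_one, one_mul]
  · rw [Finset.prod_eq_zero (f := fun k => α i - α k) (i := i)
      (Finset.mem_erase.2 ⟨Ne.symm hij, Finset.mem_univ _⟩) (sub_self _), mul_zero, map_zero,
      zero_mul]

/-- The coordinates of the uniform SV-generator are homogeneous of degree `n` ("uniform", Obs 3.5).
[cite: MediniShpilka2021, Def 3.4, Obs 3.5 (arXiv p0017:L38-L47)] -/
theorem svGenHom₁_isHomogeneous (α : Fin n ↪ K) (g : Fin n → MvPolynomial (Fin 2 ⊕ Unit) K)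
    (hg : ∀ j, g j = C (∏ k ∈ Finset.univ.erase j, (α j - α k))⁻¹ * X (Sum.inr ()) *
      ∏ k ∈ Finset.univ.erase j, (X (Sum.inl 0) - C (α k) * X (Sum.inl 1)))
    (j : Fin n) : (g j).IsHomogeneous n := by
  classical
  have hn : (Finset.univ.erase j).card + 1 = n := by
    rw [Finset.card_erase_of_mem (Finset.mem_univ j), Finset.card_univ, Fintype.card_fin]
    have := j.pos
    omega
  have h1 : (C (∏ k ∈ Finset.univ.erase j, (α j - α k))⁻¹ * X (Sum.inr ()) :
      MvPolynomial (Fin 2 ⊕ Unit) K).IsHomogeneous 1 := isHomogeneous_C_mul_X _ _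
  have h2 : (∏ k ∈ Finset.univ.erase j, (X (Sum.inl 0) - C (α k) * X (Sum.inl 1)) :
      MvPolynomial (Fin 2 ⊕ Unit) K).IsHomogeneous (∑ k ∈ Finset.univ.erase j, 1) :=
    IsHomogeneous.prod _ _ _ fun k _ =>
      (isHomogeneous_X _ _).sub ((isHomogeneous_X _ _).C_mul _)
  rw [Finset.sum_const, smul_eq_mul, mul_one] at h2
  have := h1.mul h2
  rw [add_comm, hn] at this
  rw [hg]
  exact this

/-- Individual degrees of the uniform SV-generator: `≤ n - 1` in the control variables `y_1, y_2`
and `≤ 1` in `z` (Obs 3.5: "individual degrees at most `n - 1`"; `z` enters linearly).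
[cite: MediniShpilka2021, Obs 3.5 (arXiv p0017:L47)] -/
theorem svGenHom₁_degreeOf (α : Fin n ↪ K) (g : Fin n → MvPolynomial (Fin 2 ⊕ Unit) K)
    (hg : ∀ j, g j = C (∏ k ∈ Finset.univ.erase j, (α j - α k))⁻¹ * X (Sum.inr ()) *
      ∏ k ∈ Finset.univ.erase j, (X (Sum.inl 0) - C (α k) * X (Sum.inl 1)))
    (j : Fin n) :
    (∀ s : Fin 2, degreeOf (Sum.inl s) (g j) ≤ n - 1) ∧ degreeOf (Sum.inr ()) (g j) ≤ 1 := by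
  classical
  have hcard : (Finset.univ.erase j).card = n - 1 := by
    rw [Finset.card_erase_of_mem (Finset.mem_univ j), Finset.card_univ, Fintype.card_fin]
  have hfac : ∀ (v : Fin 2 ⊕ Unit) (k : Fin n),
      degreeOf v (X (Sum.inl 0) - C (α k) * X (Sum.inl 1) : MvPolynomial (Fin 2 ⊕ Unit) K) ≤
        if v = Sum.inr () then 0 else 1 := by
    intro v k
    refine (degreeOf_sub_le _ _ _).trans (max_le ?_ ((degreeOf_C_mul_le _ _ _).trans ?_))
    · by_cases hv : v = Sum.inl 0
      · subst hv; simp [degreeOf_X_self]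
      · rw [degreeOf_X_of_ne hv]; exact Nat.zero_le _
    · by_cases hv : v = Sum.inl 1
      · subst hv; simp [degreeOf_X_self]
      · rw [degreeOf_X_of_ne hv]; exact Nat.zero_le _
  have hhead : ∀ v : Fin 2 ⊕ Unit,
      degreeOf v (C (∏ k ∈ Finset.univ.erase j, (α j - α k))⁻¹ * X (Sum.inr ()) :
        MvPolynomial (Fin 2 ⊕ Unit) K) ≤ if v = Sum.inr () then 1 else 0 := by
    intro v
    refine (degreeOf_C_mul_le _ _ _).trans ?_
    by_cases hv : v = Sum.inr ()
    · subst hv; simp [degreeOf_X_self]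
    · rw [degreeOf_X_of_ne hv, if_neg hv]
  refine ⟨fun s => ?_, ?_⟩
  · rw [hg]
    refine (degreeOf_mul_le _ _ _).trans ?_
    have h1 := hhead (Sum.inl s)
    rw [if_neg Sum.inl_ne_inr] at h1
    have h2 := (degreeOf_prod_le (Sum.inl s) (Finset.univ.erase j)
      (fun k => (X (Sum.inl 0) - C (α k) * X (Sum.inl 1) : MvPolynomial (Fin 2 ⊕ Unit) K))).trans
      (Finset.sum_le_card_nsmul _ _ 1 fun k _ => by
        have := hfac (Sum.inl s) k
        rwa [if_neg Sum.inl_ne_inr] at this)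
    rw [hcard, smul_eq_mul, mul_one] at h2
    omega
  · rw [hg]
    refine (degreeOf_mul_le _ _ _).trans ?_
    have h1 := hhead (Sum.inr ())
    rw [if_pos rfl] at h1
    have h2 := (degreeOf_prod_le (Sum.inr ()) (Finset.univ.erase j)
      (fun k => (X (Sum.inl 0) - C (α k) * X (Sum.inl 1) : MvPolynomial (Fin 2 ⊕ Unit) K))).trans
      (Finset.sum_le_card_nsmul _ _ 0 fun k _ => by
        have := hfac (Sum.inr ()) k
        rwa [if_pos rfl] at this)
    rw [smul_zero] at h2
    omega

/-- The uniform SV-generator (with its single block embedded as block `0`) is a `1`-independent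
polynomial map in the sense of Def 19. [cite: MediniShpilka2021, Obs 3.5 (arXiv p0017:L47)] -/
theorem svGenHom₁_isIndependent (α : Fin n ↪ K) (g : Fin n → MvPolynomial (Fin 2 ⊕ Unit) K)
    (hg : ∀ j, g j = C (∏ k ∈ Finset.univ.erase j, (α j - α k))⁻¹ * X (Sum.inr ()) *
      ∏ k ∈ Finset.univ.erase j, (X (Sum.inl 0) - C (α k) * X (Sum.inl 1))) :
    IsIndependent 1 (fun j => rename (Prod.mk (0 : Fin 1)) (g j)) := by
  refine ⟨fun _ => g, fun _ i => ⟨![α i, 1], fun j => svGenHom₁_spec α g hg i j⟩, fun j => ?_⟩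
  rw [Fin.sum_univ_one]

end SVGen

/-! ### The degree of a member of the continuant orbit -/

section Degree

variable (K : Type*) [Field K]

/-- `deg C_m ≤ m`. [cite: MediniShpilka2021, proof of Thm 28 (arXiv p0020:L7-L10)] -/
theorem totalDegree_cont_le (m : ℕ) : (cont K m).totalDegree ≤ m := by
  rcases Nat.eq_zero_or_pos m with rfl | hm
  · -- `C_0 = Trace(I) = 2`, a constant
    have h2 : cont K 0 = 2 := by simp [cont]
    rw [h2, show (2 : MvPolynomial (Fin 0) K) = C 2 from (map_ofNat C 2).symm, totalDegree_C]
  · obtain ⟨A, hA, hAdeg⟩ := cont_eq_prod_X_add K m hm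
    rw [hA]
    refine (totalDegree_add _ _).trans (max_le ?_ (by omega))
    refine (totalDegree_finsetProd _ _).trans ?_
    simp [totalDegree_X]

variable {K}

/-- Members of `⋃_{1 ≤ m ≤ n} C_m^{GLaff_n(K)}` have degree `≤ n`.
[cite: MediniShpilka2021, proof of Thm 28 (arXiv p0020:L12-L16)] -/
theorem totalDegree_le_of_mem_contOrbits {n : ℕ} {f : MvPolynomial (Fin n) K}
    (hf : f ∈ contOrbits K n) : f.totalDegree ≤ n := by
  obtain ⟨m, -, hmn, h, A, b, -, rfl⟩ := hf
  exact ((totalDegree_affSubst_le h A b _).trans (totalDegree_cont_le K m)).trans hmn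

end Degree

end MS2021

/-! ### The corollary -/

section Cor29

open MS2021 HittingSets

/-- **MS Cor 29 holds** (arXiv ‹Cor 1.17›), in the typed existence-and-size form with `c = 8`: over
every field with `|F| ≥ n²` (or infinite) there is a set of at most `8 · n⁶` points hitting
`⋃_{1 ≤ m ≤ n} C_m^{GLaff_n(F)}` — the grid values `Ĝ(W × W × W_z)` of the uniform SV-generator,
`|W| = n(n-1)+1`, `|W_z| = n+1` (Thm 28 + Obs 1.14).
[cite: MediniShpilka2021, Cor 29 (CCC p.19:12) and its proof (arXiv p0020:L26); Def 3.4; Obs 18 = arXiv Obs 1.14] -/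
theorem MS2021_cor_29_holds : MS2021_cor_29 := by
  classical
  refine ⟨8, fun K _ n hK => ?_⟩
  rcases Nat.eq_zero_or_pos n with rfl | hn
  · refine ⟨∅, by simp, fun f hf _ => ?_⟩
    obtain ⟨m, h1, h2, -⟩ := hf
    omega
  -- a pool of at least `n²` and at least `2` field elements
  obtain ⟨U, hU1, hU2⟩ : ∃ U : Finset K, n ^ 2 ≤ U.card ∧ 2 ≤ U.card := by
    rcases hK with hinf | hcard
    · obtain ⟨s, hs⟩ := Infinite.exists_subset_card_eq K (n ^ 2 + 2)
      exact ⟨s, by omega, by omega⟩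
    · have hn2 : 0 < n ^ 2 := pow_pos hn 2
      haveI : Finite K := Nat.finite_of_card_ne_zero (by omega)
      letI := Fintype.ofFinite K
      refine ⟨Finset.univ, ?_, ?_⟩
      · rwa [Finset.card_univ, ← Nat.card_eq_fintype_card]
      · rw [Finset.card_univ]; exact Fintype.one_lt_card
  obtain ⟨k, rfl⟩ : ∃ k, n = k + 1 := ⟨n - 1, by omega⟩
  have hsq : (k + 1) ^ 2 = (k + 1) * k + (k + 1) := by ring
  -- `W` : `n(n-1)+1` elements (control variables), `Wz` : `n+1` elements (the variable `z`)
  obtain ⟨W, hWU, hW⟩ := Finset.exists_subset_card_eq (s := U) (n := (k + 1) * k + 1) (by omega)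
  obtain ⟨Wz, -, hWz⟩ := Finset.exists_subset_card_eq (s := U) (n := k + 2)
    (by rcases Nat.eq_zero_or_pos k with rfl | hk <;> nlinarith)
  -- `n` distinct field elements `α`
  obtain ⟨T, -, hT⟩ := Finset.exists_subset_card_eq (s := W) (n := k + 1) (by nlinarith)
  let α : Fin (k + 1) ↪ K :=
    ⟨fun i => ((T.equivFin.symm (Fin.cast hT.symm i) : T) : K), fun i i' h =>
      Fin.cast_injective _ (T.equivFin.symm.injective (Subtype.val_injective h))⟩
  -- the uniform SV-generator and its block
  set g : Fin (k + 1) → MvPolynomial (Fin 2 ⊕ Unit) K := fun j =>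
    C (∏ l ∈ Finset.univ.erase j, (α j - α l))⁻¹ * X (Sum.inr ()) *
      ∏ l ∈ Finset.univ.erase j, (X (Sum.inl 0) - C (α l) * X (Sum.inl 1)) with hg
  set G : Fin (k + 1) → MvPolynomial (Fin 1 × (Fin 2 ⊕ Unit)) K := fun j =>
    rename (Prod.mk (0 : Fin 1)) (g j) with hG
  have hGind : IsIndependent 1 G := svGenHom₁_isIndependent α g fun j => rfl
  have hGunif : IsUniform G :=
    ⟨k + 1, fun j => (svGenHom₁_isHomogeneous α g (fun j => rfl) j).rename_isHomogeneous⟩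
  -- the grid
  let S : Fin 1 × (Fin 2 ⊕ Unit) → Finset K := fun v => Sum.elim (fun _ => W) (fun _ => Wz) v.2
  refine ⟨(Fintype.piFinset S).image fun x => fun i => eval x (G i), ?_, ?_⟩
  · -- size: `|W|²·|Wz| ≤ (2n²)³ = 8 n⁶`
    refine Finset.card_image_le.trans ?_
    rw [Fintype.card_piFinset]
    have hSv : ∀ v, (S v).card ≤ 2 * (k + 1) ^ 2 := by
      rintro ⟨l, s | u⟩
      · show W.card ≤ _; rw [hW]; nlinarith
      · show Wz.card ≤ _; rw [hWz]; nlinarith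
    refine (Finset.prod_le_prod' fun v _ => hSv v).trans ?_
    rw [Finset.prod_const, Finset.card_univ]
    have hcard : Fintype.card (Fin 1 × (Fin 2 ⊕ Unit)) = 3 := by simp
    rw [hcard]
    ring_nf
    exact le_rfl
  · -- hitting: Obs 1.14 on top of Thm 28
    intro f hf hf0
    by_contra hcon
    push Not at hcon
    have hP : bind₁ G f ≠ 0 := by
      obtain ⟨m, h1m, hmn, hfm⟩ := hf
      exact MS2021_thm_28_holds K (k + 1) m 2 h1m hmn f hfm G hGind hGunif
    apply hP
    refine MvPolynomial.eq_zero_of_eval_zero_at_prod_finset _ S (fun v => ?_) (fun x hx => ?_)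
    · -- individual degrees
      have hdf : f.totalDegree ≤ k + 1 := totalDegree_le_of_mem_contOrbits hf
      rcases v with ⟨l, v⟩
      obtain rfl : l = 0 := Subsingleton.elim _ _
      have hdeg := fun j => svGenHom₁_degreeOf α g (fun j => rfl) j
      rcases v with s | u
      · have hr : ∀ j, degreeOf ((0 : Fin 1), Sum.inl s) (G j) ≤ k := fun j => by
          show degreeOf _ (rename (Prod.mk (0 : Fin 1)) (g j)) ≤ k
          rw [degreeOf_rename_of_injective (Prod.mk_right_injective _)]
          simpa using (hdeg j).1 s
        have := degreeOf_bind₁_le G _ hr f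
        show degreeOf _ (bind₁ G f) < W.card
        rw [hW]
        nlinarith
      · have hr : ∀ j, degreeOf ((0 : Fin 1), Sum.inr u) (G j) ≤ 1 := fun j => by
          show degreeOf _ (rename (Prod.mk (0 : Fin 1)) (g j)) ≤ 1
          rw [degreeOf_rename_of_injective (Prod.mk_right_injective _)]
          exact (hdeg j).2
        have := degreeOf_bind₁_le G _ hr f
        show degreeOf _ (bind₁ G f) < Wz.card
        rw [hWz]
        omega
    · -- vanishing on the grid
      have hmem : (fun i => eval x (G i)) ∈ (Fintype.piFinset S).image fun x => fun i => eval x (G i) :=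
        Finset.mem_image_of_mem _ (Fintype.mem_piFinset.2 hx)
      have := hcon _ hmem
      show eval₂Hom (RingHom.id K) x (bind₁ G f) = 0
      rw [eval₂Hom_bind₁]
      exact this

end Cor29

end Literature.Computability.AlgebraicComplexity

end
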